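import Mathlib.GroupTheory.Index
import Mathlib.GroupTheory.Coset.Basic
import Mathlib.Algebra.Order.BigOperators.Group.Finset
import Mathlib.Tactic.Ring
import Literature.Combinatorics.Additive.TripleProductProperty
import Literature.Combinatorics.Additive.TripleProductPropertySAT
import Literature.Combinatorics.Additive.TPPGroupAlgebra
import Literature.Combinatorics.Additive.NeumannTPPSubgroupIndex
import Literature.Computability.AlgebraicComplexity.CohnUmansDihedralSubgroupTPP
import HarnessLib

/-!
# Murthy 2026, §2: a TPP triple with members inside a subgroup `H` of index `v` —
`|S||T||U| ≤ v^{3−k} · (a TPP product inside H)` when `k` members lie in `H`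

Topic `Literature/Combinatorics/Additive` (triple product property; companion of
`NeumannTPPSubgroupIndex.lean`, which is the case `k = 0`: Neumann 2011, Obs. 4.1, `β(G) ≤ v³ β(H)`).

S. R. Murthy, *On the triple product property for subgroups of finite nilpotent groups of class 2*,
arXiv:2602.15796 (2026), §2, verbatim (`ρ(H) = β(H)/|H|`, `β(H)` = the largest `|S||T||U|` over TPP
triples of subsets of `H`; `N_G(X)` = normaliser):

> **Proposition 2.6.** Let `(S, T, U)` be a non-trivial TPP triple of a group `G`, that is, one such
> that `|S||T||U| > |G|`. Then […] (3) If `H` is the (proper) normaliser (in `G`) of any member of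
> `{S, T, U}` and has index `n = |G : H|` then `|S|, |T|, |U|` satisfy
> (2.10) `|S||T||U| / |G| ≤ n ρ(H)` and, furthermore, if `H` is abelian, then (2.11) `|S||T||U| / |G| ≤ n`.
>
> **Proposition 2.7.** Let `G` be a group, `H` a subgroup, and `(S, T, U)` a TPP triple of `G`. If
> `S, T ⊆ H` then `|S||T||U| / |G| ≤ ρ(H)`. Additionally, if `(S, T, U)` is maximal for `G` then
> `ρ(G) ≤ ρ(H)`, and, additionally, if `H` is abelian, then `ρ(G) = 1`. […]
> *Proof.* […] let `𝒰 = {gH ∈ G/H | U ∩ gH ≠ ∅}` be the `H`-support of `U` […] `U₀ = U ∩ H` […]. Then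
> `(S, T, U₀)` forms a TPP triple of `H` such that `|S||T||U₀| / |H| ≤ ρ(H)`, and, by translation
> invariance [10, Observation 2.1] it may be supposed that any support element `gH ∈ 𝒰` intersects
> with `U` in at most `|U₀|` elements […] and `|U| ≤ n |U₀|`. […]
>
> **Corollary 2.8.** If `(S, T, U)` is a non-trivial TPP triple of a nonabelian group `G`, that is,
> such that `|S||T||U| > |G|`, then no two members `X, Y ∈ {S, T, U}` generate an abelian subgroup,
> that is, the subgroups `⟨S, T⟩, ⟨S, U⟩, ⟨T, U⟩` are all nonabelian.
> *Proof.* Use Proposition 2.7 and let `H = ⟨X, Y⟩` for any two `X, Y ∈ {S, T, U}`.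

## What is here (all proved; 0 named facts; no capacity function `β`/`ρ` is introduced — every
statement quantifies over the TPP triple, exactly as in `NeumannTPPSubgroupIndex.lean`)

Write `v = [G : H]`.  The tree's `TripleProductProperty` is the right-quotient form
`s s'⁻¹ · t t'⁻¹ · u u'⁻¹ = 1 ⇒ …`, which is invariant under independent RIGHT translations
(`TripleProductProperty.map_mulRight`); accordingly the proofs below use right cosets `Hx` where the
note uses left cosets `gH` — the statements are unaffected.

* `Murthy2026.exists_third_inside` — for every TPP triple `(S, T, U)` there is `U₁ ⊆ H` with
  `(S, T, U₁)` a TPP triple and `|U| ≤ v |U₁|` (`U₁ = U x⁻¹ ∩ H` for a heaviest right coset `Hx`);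
  `Murthy2026.exists_two_inside` — the same for two members at once (`T₁, U₁ ⊆ H`,
  `|T| ≤ v|T₁|`, `|U| ≤ v|U₁|`).
* `Murthy2026_prop27` — **Prop. 2.7** (`k = 2`): if `S, T ⊆ H` there is a TPP triple `(S, T, U₁)` of
  subsets of `H` with `|S||T||U| ≤ v · |S||T||U₁|` (i.e. `|S||T||U|/|G| ≤ ρ(H)`);
  `Murthy2026_prop27_abelian` (+ `₁₃`, `₂₃` for the other two pairs) — if moreover `H` is abelian,
  `|S||T||U| ≤ |G|` (the triple is trivial), through the abelian packing bound
  `Neumann2011.tpp_card_le_of_subset_comm` (Cohn–Umans 2003, Lemma 3.1).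
* `Murthy2026_cor28` (+ `₁₃`, `₂₃`) — **Cor. 2.8** in contrapositive form: if two members generate an
  abelian subgroup (`Subgroup.closure (X ∪ Y)` commutative) then `|S||T||U| ≤ |G|`.
* `Murthy2026_prop26_3` — **Prop. 2.6 (3)** (`k = 1`), proved for EVERY subgroup `H` containing a
  member (the note states it for `H = N_G(X)`, the normaliser of the member `X`; its proof uses only
  `X ⊆ H`): if `S ⊆ H` there is a TPP triple `(S, T₁, U₁)` of subsets of `H` with
  `|S||T||U| ≤ v² · |S||T₁||U₁|` ((2.10): `|S||T||U|/|G| ≤ n ρ(H)`), and `Murthy2026_prop26_3_abelian`: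
  `|S||T||U| ≤ v |G|` if `H` is abelian ((2.11)).

* Subgroup TPP triples ("There is a subgroup version of this where 'TPP triple' is replaced by
  'subgroup TPP triple', `ρ(G)` by `ρ₀(G)`, and `ρ(H)` by `ρ₀(H)`", Prop. 2.7): the bridge
  `tripleProductProperty_of_subgroupTPP` (the tree's `SubgroupTPP` of three subgroups gives the
  right-quotient TPP of their underlying finite sets), `Murthy2026.card_le_index_mul_card_inf`
  (`|U| ≤ v |U ∩ H|` for subgroups), `Murthy2026_prop27_subgroup_abelian` (`S, T ≤ H` abelian ⇒
  `|S||T||U| ≤ |G|`) and `Murthy2026_cor28_subgroup` (`S ⊔ T` abelian ⇒ `|S||T||U| ≤ |G|`).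

Not formalised here: Prop. 2.6 (1)–(2) (permutability / non-normality of the members; for SUBGROUP
triples the non-normality is the tree's `SubgroupTPP.card_mul_card_normalizer_inf_mul_card_le`,
`Literature/Barriers/MatrixMultiplication/NormalizerBarrier.lean`, BCGPU 2023 Thm. 3.6), the
"maximal triple" rephrasings (`ρ(G) ≤ ρ(H)`, `ρ₀(G) ≤ ρ₀(H)`).

## References
* S. R. Murthy, arXiv:2602.15796 (2026): Prop. 2.6 (3) (p. 5, eqs. (2.10)–(2.11)), Prop. 2.7 (p. 6),
  Cor. 2.8 (p. 7). [Murthy2026]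
* P. M. Neumann, LMS J. Comput. Math. 14 (2011) 232–237: Obs. 2.1 (translation), Obs. 4.1 (the
  heaviest-coset argument). [Neumann2011]
* H. Cohn, C. Umans, FOCS 2003, arXiv:math/0307321, Lemma 3.1 (abelian packing bound). [CohnUmans2003]
-/

namespace Literature.Combinatorics.Additive

open Finset

variable {G : Type*} [Group G]

namespace Murthy2026

/-- Right translation by `1` is the identity on finite sets (bookkeeping for `map_mulRight`).
[folklore] -/
private theorem map_mulRight_one (X : Finset G) : X.map (Equiv.mulRight (1 : G)).toEmbedding = X := by
  ext x
  simp only [Finset.mem_map_equiv, Equiv.mulRight_symm_apply, inv_one, mul_one]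

/-- Translating only the third set of a TPP triple on the right keeps the TPP
(`TripleProductProperty.map_mulRight` with `a = b = 1`). [cite: Neumann2011, Observation 2.1]
[cite: Murthy2026, Proposition 2.7 (proof: "by translation invariance")] -/
theorem tpp_map_mulRight_third {S T U : Finset G} (h : TripleProductProperty S T U) (c : G) :
    TripleProductProperty S T (U.map (Equiv.mulRight c).toEmbedding) := by
  have h' := h.map_mulRight 1 1 c
  rwa [map_mulRight_one, map_mulRight_one] at h'

/-- Translating the second and third sets of a TPP triple on the right keeps the TPP.
[cite: Neumann2011, Observation 2.1] -/
theorem tpp_map_mulRight_two {S T U : Finset G} (h : TripleProductProperty S T U) (b c : G) :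
    TripleProductProperty S (T.map (Equiv.mulRight b).toEmbedding)
      (U.map (Equiv.mulRight c).toEmbedding) := by
  have h' := h.map_mulRight 1 b c
  rwa [map_mulRight_one] at h'

/-- **The support step of Prop. 2.7**: for every TPP triple `(S, T, U)` of `G` and every subgroup `H`
of finite index `v` there is `U₁ ⊆ H` — namely `U₁ = U x⁻¹ ∩ H` for a right coset `Hx` meeting `U` in
the most points — such that `(S, T, U₁)` is again a TPP triple and `|U| ≤ v |U₁|`
("`|U ∩ gH| ≤ |U₀|` for all `gH ∈ 𝒰` … and `|U| ≤ n |U₀|`"). [cite: Murthy2026, Proposition 2.7 (proof)]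
[cite: Neumann2011, Observation 4.1 (proof)] -/
theorem exists_third_inside [Finite G] (H : Subgroup G) [DecidablePred (· ∈ H)] {S T U : Finset G}
    (h : TripleProductProperty S T U) :
    ∃ U₁ : Finset G, (∀ u ∈ U₁, u ∈ H) ∧ TripleProductProperty S T U₁ ∧
      U.card ≤ H.index * U₁.card := by
  obtain ⟨c, hc⟩ := Neumann2011.exists_heavy_rightCoset H U
  refine ⟨(U.map (Equiv.mulRight c⁻¹).toEmbedding).filter (· ∈ H),
    fun u hu => (Finset.mem_filter.1 hu).2,
    (tpp_map_mulRight_third h c⁻¹).mono subset_rfl subset_rfl (Finset.filter_subset _ _), ?_⟩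
  rwa [Neumann2011.card_filter_map_mulRight]

/-- The two-set version of the support step: `T₁ = T b⁻¹ ∩ H`, `U₁ = U c⁻¹ ∩ H` for heaviest right
cosets `Hb`, `Hc` give a TPP triple `(S, T₁, U₁)` with `|T| ≤ v|T₁|`, `|U| ≤ v|U₁|`.
[cite: Murthy2026, Proposition 2.6 (3) (proof: "using independent right-translation of T and U
[10, Observation 4.1] it can be supposed that |T₀| ≥ |T ∩ yH| and |U₀| ≥ |U ∩ zH|")] -/
theorem exists_two_inside [Finite G] (H : Subgroup G) [DecidablePred (· ∈ H)] {S T U : Finset G}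
    (h : TripleProductProperty S T U) :
    ∃ T₁ U₁ : Finset G, (∀ t ∈ T₁, t ∈ H) ∧ (∀ u ∈ U₁, u ∈ H) ∧ TripleProductProperty S T₁ U₁ ∧
      T.card ≤ H.index * T₁.card ∧ U.card ≤ H.index * U₁.card := by
  obtain ⟨b, hb⟩ := Neumann2011.exists_heavy_rightCoset H T
  obtain ⟨c, hc⟩ := Neumann2011.exists_heavy_rightCoset H U
  refine ⟨(T.map (Equiv.mulRight b⁻¹).toEmbedding).filter (· ∈ H),
    (U.map (Equiv.mulRight c⁻¹).toEmbedding).filter (· ∈ H),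
    fun t ht => (Finset.mem_filter.1 ht).2, fun u hu => (Finset.mem_filter.1 hu).2,
    (tpp_map_mulRight_two h b⁻¹ c⁻¹).mono subset_rfl (Finset.filter_subset _ _)
      (Finset.filter_subset _ _), ?_, ?_⟩
  · rwa [Neumann2011.card_filter_map_mulRight]
  · rwa [Neumann2011.card_filter_map_mulRight]

end Murthy2026

open Murthy2026

/-! ## Prop. 2.7: two members inside `H` -/

/-- **Murthy 2026, Proposition 2.7** (`|S||T||U|/|G| ≤ ρ(H)`, stated on the triples): if `(S, T, U)`
is a TPP triple of `G` with `S, T ⊆ H`, `[G : H] = v`, then there is a TPP triple `(S, T, U₁)` of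
subsets of `H` with `|S||T||U| ≤ v · |S||T||U₁|` (so `|S||T||U| ≤ v β(H)`, i.e.
`|S||T||U|/|G| ≤ ρ(H)`). [cite: Murthy2026, Proposition 2.7] -/
theorem Murthy2026_prop27 [Finite G] (H : Subgroup G) [DecidablePred (· ∈ H)] {S T U : Finset G}
    (h : TripleProductProperty S T U) (hS : ∀ s ∈ S, s ∈ H) (hT : ∀ t ∈ T, t ∈ H) :
    ∃ U₁ : Finset G, (∀ s ∈ S, s ∈ H) ∧ (∀ t ∈ T, t ∈ H) ∧ (∀ u ∈ U₁, u ∈ H) ∧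
      TripleProductProperty S T U₁ ∧
      S.card * T.card * U.card ≤ H.index * (S.card * T.card * U₁.card) := by
  obtain ⟨U₁, hU₁, h₁, hle⟩ := exists_third_inside H h
  refine ⟨U₁, hS, hT, hU₁, h₁, ?_⟩
  calc S.card * T.card * U.card ≤ S.card * T.card * (H.index * U₁.card) := Nat.mul_le_mul_left _ hle
    _ = H.index * (S.card * T.card * U₁.card) := by ring

/-- **Murthy 2026, Proposition 2.7, abelian case** ("additionally, if `H` is abelian, then
`ρ(G) = 1`"): a TPP triple two of whose members lie in a common abelian subgroup `H` is trivial,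
`|S||T||U| ≤ |G|` (Prop. 2.7 and the abelian packing bound `β(H) ≤ |H|`, `v |H| = |G|`).
[cite: Murthy2026, Proposition 2.7] [cite: CohnUmans2003, Lemma 3.1] -/
theorem Murthy2026_prop27_abelian [Fintype G] (H : Subgroup G) [DecidablePred (· ∈ H)]
    (hcomm : ∀ a ∈ H, ∀ b ∈ H, a * b = b * a) {S T U : Finset G} (h : TripleProductProperty S T U)
    (hS : ∀ s ∈ S, s ∈ H) (hT : ∀ t ∈ T, t ∈ H) :
    S.card * T.card * U.card ≤ Fintype.card G := by
  obtain ⟨U₁, -, -, hU₁, h₁, hle⟩ := Murthy2026_prop27 H h hS hT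
  have hH : S.card * T.card * U₁.card ≤ Nat.card H :=
    Neumann2011.tpp_card_le_of_subset_comm H hcomm h₁ hS hT hU₁
  have hG : H.index * Nat.card H = Fintype.card G := by
    rw [← Nat.card_eq_fintype_card, mul_comm]; exact H.card_mul_index
  calc S.card * T.card * U.card ≤ H.index * (S.card * T.card * U₁.card) := hle
    _ ≤ H.index * Nat.card H := Nat.mul_le_mul_left _ hH
    _ = Fintype.card G := hG

/-- Prop. 2.7, abelian case, for the pair `S, U ⊆ H`. [cite: Murthy2026, Proposition 2.7] -/
theorem Murthy2026_prop27_abelian₁₃ [Fintype G] (H : Subgroup G) [DecidablePred (· ∈ H)]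
    (hcomm : ∀ a ∈ H, ∀ b ∈ H, a * b = b * a) {S T U : Finset G} (h : TripleProductProperty S T U)
    (hS : ∀ s ∈ S, s ∈ H) (hU : ∀ u ∈ U, u ∈ H) :
    S.card * T.card * U.card ≤ Fintype.card G := by
  have := Murthy2026_prop27_abelian H hcomm h.rotate.rotate hU hS
  calc S.card * T.card * U.card = U.card * S.card * T.card := by ring
    _ ≤ Fintype.card G := this

/-- Prop. 2.7, abelian case, for the pair `T, U ⊆ H`. [cite: Murthy2026, Proposition 2.7] -/
theorem Murthy2026_prop27_abelian₂₃ [Fintype G] (H : Subgroup G) [DecidablePred (· ∈ H)]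
    (hcomm : ∀ a ∈ H, ∀ b ∈ H, a * b = b * a) {S T U : Finset G} (h : TripleProductProperty S T U)
    (hT : ∀ t ∈ T, t ∈ H) (hU : ∀ u ∈ U, u ∈ H) :
    S.card * T.card * U.card ≤ Fintype.card G := by
  have := Murthy2026_prop27_abelian H hcomm h.rotate hT hU
  calc S.card * T.card * U.card = T.card * U.card * S.card := by ring
    _ ≤ Fintype.card G := this

/-- Prop. 2.7, abelian case, with the commutativity hypothesis as the class `IsMulCommutative H`.
[cite: Murthy2026, Proposition 2.7] -/
theorem Murthy2026_prop27_abelian' [Fintype G] (H : Subgroup G) [DecidablePred (· ∈ H)]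
    [IsMulCommutative H] {S T U : Finset G} (h : TripleProductProperty S T U)
    (hS : ∀ s ∈ S, s ∈ H) (hT : ∀ t ∈ T, t ∈ H) :
    S.card * T.card * U.card ≤ Fintype.card G :=
  Murthy2026_prop27_abelian H (fun _ ha _ hb => setLike_mul_comm ha hb) h
    hS hT

/-! ## Cor. 2.8: no two members of a non-trivial TPP triple generate an abelian subgroup -/

/-- **Murthy 2026, Corollary 2.8** (contrapositive form, pair `S, T`): if the subgroup `⟨S, T⟩`
generated by two members of a TPP triple is abelian, the triple is trivial: `|S||T||U| ≤ |G|`.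
[cite: Murthy2026, Corollary 2.8] -/
theorem Murthy2026_cor28 [Fintype G] {S T U : Finset G} (h : TripleProductProperty S T U)
    (hST : ∀ a ∈ Subgroup.closure ((S : Set G) ∪ T), ∀ b ∈ Subgroup.closure ((S : Set G) ∪ T),
      a * b = b * a) :
    S.card * T.card * U.card ≤ Fintype.card G := by
  classical
  exact Murthy2026_prop27_abelian (Subgroup.closure ((S : Set G) ∪ T)) hST h
    (fun s hs => Subgroup.subset_closure (Set.mem_union_left _ (Finset.mem_coe.2 hs)))
    (fun t ht => Subgroup.subset_closure (Set.mem_union_right _ (Finset.mem_coe.2 ht)))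

/-- **Murthy 2026, Corollary 2.8**, pair `S, U`. [cite: Murthy2026, Corollary 2.8] -/
theorem Murthy2026_cor28₁₃ [Fintype G] {S T U : Finset G} (h : TripleProductProperty S T U)
    (hSU : ∀ a ∈ Subgroup.closure ((S : Set G) ∪ U), ∀ b ∈ Subgroup.closure ((S : Set G) ∪ U),
      a * b = b * a) :
    S.card * T.card * U.card ≤ Fintype.card G := by
  classical
  exact Murthy2026_prop27_abelian₁₃ (Subgroup.closure ((S : Set G) ∪ U)) hSU h
    (fun s hs => Subgroup.subset_closure (Set.mem_union_left _ (Finset.mem_coe.2 hs)))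
    (fun u hu => Subgroup.subset_closure (Set.mem_union_right _ (Finset.mem_coe.2 hu)))

/-- **Murthy 2026, Corollary 2.8**, pair `T, U`. [cite: Murthy2026, Corollary 2.8] -/
theorem Murthy2026_cor28₂₃ [Fintype G] {S T U : Finset G} (h : TripleProductProperty S T U)
    (hTU : ∀ a ∈ Subgroup.closure ((T : Set G) ∪ U), ∀ b ∈ Subgroup.closure ((T : Set G) ∪ U),
      a * b = b * a) :
    S.card * T.card * U.card ≤ Fintype.card G := by
  classical
  exact Murthy2026_prop27_abelian₂₃ (Subgroup.closure ((T : Set G) ∪ U)) hTU h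
    (fun t ht => Subgroup.subset_closure (Set.mem_union_left _ (Finset.mem_coe.2 ht)))
    (fun u hu => Subgroup.subset_closure (Set.mem_union_right _ (Finset.mem_coe.2 hu)))

/-- **Murthy 2026, Corollary 2.8, as printed** (all three pairs at once): a non-trivial TPP triple,
`|S||T||U| > |G|`, has no two members generating an abelian subgroup.
[cite: Murthy2026, Corollary 2.8] -/
theorem Murthy2026_cor28_nontrivial [Fintype G] {S T U : Finset G} (h : TripleProductProperty S T U)
    (hbig : Fintype.card G < S.card * T.card * U.card) :
    (¬ ∀ a ∈ Subgroup.closure ((S : Set G) ∪ T), ∀ b ∈ Subgroup.closure ((S : Set G) ∪ T),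
        a * b = b * a) ∧
    (¬ ∀ a ∈ Subgroup.closure ((S : Set G) ∪ U), ∀ b ∈ Subgroup.closure ((S : Set G) ∪ U),
        a * b = b * a) ∧
    (¬ ∀ a ∈ Subgroup.closure ((T : Set G) ∪ U), ∀ b ∈ Subgroup.closure ((T : Set G) ∪ U),
        a * b = b * a) :=
  ⟨fun hc => absurd (Murthy2026_cor28 h hc) (not_le.2 hbig),
    fun hc => absurd (Murthy2026_cor28₁₃ h hc) (not_le.2 hbig),
    fun hc => absurd (Murthy2026_cor28₂₃ h hc) (not_le.2 hbig)⟩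

/-! ## Prop. 2.6 (3): one member inside `H` -/

/-- **Murthy 2026, Proposition 2.6 (3), eq. (2.10)** (`|S||T||U|/|G| ≤ n ρ(H)`, stated on the
triples, for every subgroup `H ⊇ S` of index `v` — the note takes `H = N_G(S)`; its proof uses only
`S ⊆ H`): there is a TPP triple `(S, T₁, U₁)` of subsets of `H` with `|S||T||U| ≤ v² · |S||T₁||U₁|`.
[cite: Murthy2026, Proposition 2.6 (3)] [cite: Neumann2011, Observation 4.1] -/
theorem Murthy2026_prop26_3 [Finite G] (H : Subgroup G) [DecidablePred (· ∈ H)] {S T U : Finset G}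
    (h : TripleProductProperty S T U) (hS : ∀ s ∈ S, s ∈ H) :
    ∃ T₁ U₁ : Finset G, (∀ s ∈ S, s ∈ H) ∧ (∀ t ∈ T₁, t ∈ H) ∧ (∀ u ∈ U₁, u ∈ H) ∧
      TripleProductProperty S T₁ U₁ ∧
      S.card * T.card * U.card ≤ H.index ^ 2 * (S.card * T₁.card * U₁.card) := by
  obtain ⟨T₁, U₁, hT₁, hU₁, h₁, hT, hU⟩ := exists_two_inside H h
  refine ⟨T₁, U₁, hS, hT₁, hU₁, h₁, ?_⟩
  calc S.card * T.card * U.card ≤ S.card * (H.index * T₁.card) * (H.index * U₁.card) :=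
        Nat.mul_le_mul (Nat.mul_le_mul_left _ hT) hU
    _ = H.index ^ 2 * (S.card * T₁.card * U₁.card) := by ring

/-- **Murthy 2026, Proposition 2.6 (3), eq. (2.11)** (abelian `H ⊇ S` of index `v`:
`|S||T||U|/|G| ≤ n`): `|S||T||U| ≤ v |G|`. [cite: Murthy2026, Proposition 2.6 (3)]
[cite: CohnUmans2003, Lemma 3.1] -/
theorem Murthy2026_prop26_3_abelian [Fintype G] (H : Subgroup G) [DecidablePred (· ∈ H)]
    (hcomm : ∀ a ∈ H, ∀ b ∈ H, a * b = b * a) {S T U : Finset G} (h : TripleProductProperty S T U)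
    (hS : ∀ s ∈ S, s ∈ H) :
    S.card * T.card * U.card ≤ H.index * Fintype.card G := by
  obtain ⟨T₁, U₁, -, hT₁, hU₁, h₁, hle⟩ := Murthy2026_prop26_3 H h hS
  have hH : S.card * T₁.card * U₁.card ≤ Nat.card H :=
    Neumann2011.tpp_card_le_of_subset_comm H hcomm h₁ hS hT₁ hU₁
  have hG : H.index * Nat.card H = Fintype.card G := by
    rw [← Nat.card_eq_fintype_card, mul_comm]; exact H.card_mul_index
  calc S.card * T.card * U.card ≤ H.index ^ 2 * (S.card * T₁.card * U₁.card) := hle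
    _ ≤ H.index ^ 2 * Nat.card H := Nat.mul_le_mul_left _ hH
    _ = H.index * (H.index * Nat.card H) := by ring
    _ = H.index * Fintype.card G := by rw [hG]

/-- Prop. 2.6 (3), abelian case, for the member `T ⊆ H`. [cite: Murthy2026, Proposition 2.6 (3)] -/
theorem Murthy2026_prop26_3_abelian₂ [Fintype G] (H : Subgroup G) [DecidablePred (· ∈ H)]
    (hcomm : ∀ a ∈ H, ∀ b ∈ H, a * b = b * a) {S T U : Finset G} (h : TripleProductProperty S T U)
    (hT : ∀ t ∈ T, t ∈ H) :
    S.card * T.card * U.card ≤ H.index * Fintype.card G := by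
  have := Murthy2026_prop26_3_abelian H hcomm h.rotate hT
  calc S.card * T.card * U.card = T.card * U.card * S.card := by ring
    _ ≤ H.index * Fintype.card G := this

/-- Prop. 2.6 (3), abelian case, for the member `U ⊆ H`. [cite: Murthy2026, Proposition 2.6 (3)] -/
theorem Murthy2026_prop26_3_abelian₃ [Fintype G] (H : Subgroup G) [DecidablePred (· ∈ H)]
    (hcomm : ∀ a ∈ H, ∀ b ∈ H, a * b = b * a) {S T U : Finset G} (h : TripleProductProperty S T U)
    (hU : ∀ u ∈ U, u ∈ H) :
    S.card * T.card * U.card ≤ H.index * Fintype.card G := by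
  have := Murthy2026_prop26_3_abelian H hcomm h.rotate.rotate hU
  calc S.card * T.card * U.card = U.card * S.card * T.card := by ring
    _ ≤ H.index * Fintype.card G := this

/-! ## Subgroup TPP triples (the `ρ₀` version of Prop. 2.7) -/

section Subgroups

open Literature.Computability.AlgebraicComplexity.DihedralSubgroups

/-- For three SUBGROUPS the subgroup form `SubgroupTPP` (`h₁ h₂ h₃ = 1 ⇒ hᵢ = 1`) gives back the tree's
right-quotient `TripleProductProperty` of the underlying finite sets, because `Q(Hᵢ) = Hᵢ Hᵢ⁻¹ = Hᵢ`
(converse of `subgroupTPP_of_tripleProductProperty`). [cite: CohnUmans2003, Def. 2.1 (remark: "if the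
Sᵢ are subgroups … the condition simplifies")] -/
theorem tripleProductProperty_of_subgroupTPP [Fintype G] (H₁ H₂ H₃ : Subgroup G)
    [DecidablePred (· ∈ H₁)] [DecidablePred (· ∈ H₂)] [DecidablePred (· ∈ H₃)]
    (h : SubgroupTPP H₁ H₂ H₃) :
    TripleProductProperty (univ.filter (· ∈ H₁)) (univ.filter (· ∈ H₂)) (univ.filter (· ∈ H₃)) := by
  intro s hs s' hs' t ht t' ht' u hu u' hu' he
  simp only [Finset.mem_filter, Finset.mem_univ, true_and] at hs hs' ht ht' hu hu'
  obtain ⟨h1, h2, h3⟩ := h _ (H₁.mul_mem hs (H₁.inv_mem hs')) _ (H₂.mul_mem ht (H₂.inv_mem ht'))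
    _ (H₃.mul_mem hu (H₃.inv_mem hu')) he
  exact ⟨mul_inv_eq_one.1 h1, mul_inv_eq_one.1 h2, mul_inv_eq_one.1 h3⟩

/-- "`|U| ≤ n |U₀|`" for a subgroup `U` and `U₀ = U ∩ H`: `|U| = |U ∩ H| · [U : U ∩ H]` and
`[U : U ∩ H] = [UH-cosets] ≤ [G : H]`. [cite: Murthy2026, Proposition 2.7 (proof, subgroup version)] -/
theorem Murthy2026.card_le_index_mul_card_inf [Finite G] (H U : Subgroup G) :
    Nat.card U ≤ H.index * Nat.card ↥(U ⊓ H) := by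
  have h1 : Nat.card ↥(U ⊓ H) * (U ⊓ H).relIndex U = Nat.card U := by
    have h3 := Subgroup.relIndex_mul_relIndex (H := ⊥) (K := U ⊓ H) (L := U) bot_le inf_le_left
    rwa [Subgroup.relIndex_bot_left, Subgroup.relIndex_bot_left] at h3
  have h2 : (U ⊓ H).relIndex U ≤ H.index := by
    rw [inf_comm, Subgroup.inf_relIndex_right, ← Subgroup.relIndex_top_right]
    exact Subgroup.relIndex_le_of_le_right le_top
      (by rw [Subgroup.relIndex_top_right]; exact Subgroup.index_ne_zero_of_finite)
  calc Nat.card U = Nat.card ↥(U ⊓ H) * (U ⊓ H).relIndex U := h1.symm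
    _ ≤ Nat.card ↥(U ⊓ H) * H.index := Nat.mul_le_mul_left _ h2
    _ = H.index * Nat.card ↥(U ⊓ H) := mul_comm _ _

/-- **Murthy 2026, Proposition 2.7, subgroup version, abelian case**: a subgroup TPP triple two of whose
members lie in a common abelian subgroup `H` is trivial, `|S||T||U| ≤ |G|` (`ρ₀`-form of "if `H` is
abelian, then `ρ(G) = 1`"). [cite: Murthy2026, Proposition 2.7] [cite: CohnUmans2003, Lemma 3.1] -/
theorem Murthy2026_prop27_subgroup_abelian [Finite G] (H : Subgroup G) [IsMulCommutative H]
    {S T U : Subgroup G} (h : SubgroupTPP S T U) (hS : S ≤ H) (hT : T ≤ H) :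
    Nat.card S * Nat.card T * Nat.card U ≤ Nat.card G := by
  classical
  let _ := Fintype.ofFinite G
  have key := Murthy2026_prop27_abelian H (fun _ ha _ hb => setLike_mul_comm ha hb)
    (tripleProductProperty_of_subgroupTPP S T U h)
    (fun s hs => hS (Finset.mem_filter.1 hs).2) (fun t ht => hT (Finset.mem_filter.1 ht).2)
  have hc : ∀ (K : Subgroup G), (univ.filter (· ∈ K)).card = Nat.card K := fun K => by
    rw [Nat.card_eq_fintype_card (α := ↥K), ← Fintype.card_subtype]
  rw [hc, hc, hc, ← Nat.card_eq_fintype_card] at key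
  exact key

/-- **Murthy 2026, Corollary 2.8, subgroup version** (pair `S, T`): if `⟨S, T⟩ = S ⊔ T` is abelian,
a subgroup TPP triple `(S, T, U)` is trivial, `|S||T||U| ≤ |G|`. [cite: Murthy2026, Corollary 2.8] -/
theorem Murthy2026_cor28_subgroup [Finite G] {S T U : Subgroup G} [IsMulCommutative ↥(S ⊔ T)]
    (h : SubgroupTPP S T U) : Nat.card S * Nat.card T * Nat.card U ≤ Nat.card G :=
  Murthy2026_prop27_subgroup_abelian (S ⊔ T) h le_sup_left le_sup_right

end Subgroups

end Literature.Combinatorics.Additive
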